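import Literature.NumberTheory.LFunctions.CertifiedDirichletLTuringAbs
import Literature.NumberTheory.LFunctions.RiemannMethodGRHVerificationProofs
import Literature.NumberTheory.LFunctions.HurwitzCertifiedEvaluation
import HarnessLib

/-!
# Turing's method for a REAL primitive character from SIGN-CHANGE data (Rumely's F-point format):
# the certificate schema, and its instances for conductors `3, 4, 5, 7, 8`

Topic `Literature/NumberTheory/LFunctions`; namespace `Literature.NumberTheory.LFunctions`.  PROVED theorems only
(no named fact, no `sorry`; STANDARD axioms: the tree's certified `ζ` numerics enter as the hypothesis
`TrudgianNumerics.trudgianCheck = true`, exactly as in `LFunctionRHUpTo.of_turing_numeric`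
(`CertifiedDirichletLTuringHolds.lean`); it is discharged by `TrudgianNumerics.trudgianCheck_eq_true`
(`native_decide`, computational lane) at the point of use).
Typed for the cell parity-realchar, TARGET §2 row 24 (director-frontier 2026-08-27 (ii): «instantiate
`LFunctionRHUpTo.of_turing_isQuadratic` for q ∈ {3,4,5,7,8} from the single-character Turing bound»).

## What is here

`LFunctionRHUpTo.of_turing_numeric` (`CertifiedDirichletLTuringHolds.lean`; for quadratic `χ` packaged as
`LFunctionRHUpTo.of_turing_isQuadratic`, `CertifiedDirichletLTuringReal.lean`) certifies GRH for a primitive `χ`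
up to height `T` from EXACT zero ordinates `W` (`|γ| ≤ T`), `Z` (`T < γ ≤ T + h`) and one decimal inequality.  A computation never produces exact ordinates: it produces Rumely's PHASE-II data (Math. Comp. 61
(1993) §2 p. 424, §3 Proposition 3 p. 428, §4 p. 433: «"F-points" between each pair of zeros, the function values
`Z(t, χ)` at the F-points, and error bounds» — points where the sign of the real function `Z(t, χ)` is rigorously
determined, alternating).  For a real character the tree already has the matching notion: Hiary–Ireland–Kyi's
sign-change data `HiaryIrelandKyi2026.IsSignChangeData χ τ 𝒵` (`RiemannMethodGRHVerification.lean`: disjoint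
intervals `[γ₋, γ₊] ⊆ [0, τ]` in each of which the REAL function `ξ(½ + it, χ)` (`dirichletXi`, real on the line for
quadratic `χ`, `dirichletXi_criticalLine_im_eq_zero_of_isQuadratic`) takes both signs), and the IVT step
`HiaryIrelandKyi2026.exists_zero_of_signChange`.  This file joins the two:

* `TuringDirichlet.LFunction_conj_eq_zero_iff_of_isQuadratic`, `TuringDirichlet.im_ne_neg_of_forall_im_ne` — for
  a quadratic `χ` the zeros of `L(s, χ)` are symmetric under `s ↦ s̄` (`conj L(s̄, χ) = L(s, χ̄) = L(s, χ)`), so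
  zero data is needed on the POSITIVE side only and the non-ordinate side conditions at `±T` reduce to `+T`;
* `TuringDirichlet.exists_zeroSelector` — sign-change data select distinct critical zeros, one per interval;
* `LFunctionRHUpTo.of_turing_real` / `of_turing_real'` — the most general form: `n` found critical zeros with
  `|γ| ≤ T`, found zeros `Z ⊂ (T, T+h]` with any certified lower bound `S ≤ Σ_Z (T + h − γ)`, and the inequality
  `2(2.26 + 0.0642 log(q(T+h)/2π)) + (2/π)∫_T^{T+h}θ − 2S < h(n+1)` ⇒ `LFunctionRHUpTo χ T ∧ N_χ(T) = n`
  (primed = no side condition on the heights, see below);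
* `LFunctionRHUpTo.of_turing_foundZeros` / `of_turing_foundZeros'` — the same with sign-change data above `T`
  (`exists_zerosAbove_of_signChangeData`: `S = Σ_P (T + h − b_P)`);
* **`LFunctionRHUpTo.of_turing_signChanges`** — THE SCHEMA: `χ` quadratic primitive mod `q > 1`, `T > 50`, `h > 0`,
  `T` and `T + h` ordinates of no non-trivial zero, sign-change data `𝒵₁` on `[0, T]` (`m = #𝒵₁` intervals) and
  `𝒵₂` inside `(T, T + h]`, and the single decimal inequality
  `2(2.26 + 0.0642 log(q(T+h)/2π)) + (2/π)∫_T^{T+h} θ(t,χ)dt − 2 Σ_{[a,b]∈𝒵₂} (T + h − b) < h(2m + 1)`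
  (each zero of `(T, T+h]` replaced by the upper end of its interval — Rumely's device «replacing each `ρ` by
  the next F-point», p. 434 — which only weakens the left side) give
  `LFunctionRHUpTo χ T ∧ N_χ(T) = N_{χ,0}(T) = 2m`;
* **`LFunctionRHUpTo.of_turing_signChanges'`** — the same WITHOUT the two side conditions on the heights: the
  schema is applied at nearby heights `T' ∈ (T, T+η)`, `U' ∈ (T+h−η, T+h)` through no zero (all but finitely
  many heights qualify, `TuringDirichlet.exists_nonOrdinate`), the strict inequality surviving a perturbation
  below its slack (`|θ| ≤ M` on `[T, T+h]`), and `N_χ(T) ≤ N_χ(T') = 2m ≤ N_{χ,0}(T)` closes the sandwich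
  (Rumely p. 426: «Even if `t₁` or `t₂` is the ordinate of a zero, the ERH can still be established»).  So a
  certificate is: sign-change data + an enclosure of `∫_T^{T+h} θ` + one decimal comparison, nothing else;
* `TuringDirichlet.exists_selector_of_alternating`, `exists_criticalZeros_of_alternating`,
  `exists_zerosAbove_of_alternating`, **`LFunctionRHUpTo.of_turing_FPoints`** (F-points below `T`, sign-change
  data above), **`LFunctionRHUpTo.of_turing_FPointLists`** (F-point lists below AND above `T`) — Rumely's own
  Proposition-3 format: `0 ≤ t₀ < t₁ < ⋯ < t_m ≤ T` with `Re ξ(½+it_{i−1},χ)·Re ξ(½+it_i,χ) < 0` (consecutive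
  closed intervals share endpoints, so this is not `IsSignChangeData`, but the endpoints are not zeros and the `m`
  zeros are interior and distinct), and likewise `T ≤ u₀ < ⋯ < u_k ≤ T + h` above, with `S = Σ_j (T + h − u_j)`;
* the instances `LFunctionRHUpTo.of_turing_signChanges_mod3 / _mod4 / _mod5 / _mod7 / _mod8` for the real
  primitive characters of conductor `3, 4, 5, 7, 8` (quadraticity is automatic mod `3, 4, 8`:
  `TuringDirichlet.isQuadratic_of_units_sq_eq_one`, `HurwitzNumerics.isQuadratic_of_modulus_four`), i.e. the kernel route by which the rows of Rumely's Tables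
  5.4/5.5 for these characters (`RumelyZeroTablesSmallConductors.lean`: e.g. `46` zeros of `L(s, (−3/·))` with
  `0 < γ < 100`) would be RE-CERTIFIED from F-point data: `m = 46` sign changes below `T = 100` + a few above +
  one inequality ⇒ `LFunctionRHUpTo χ 100 ∧ N_χ(100) = 92`.

The phase `θ(t, χ) = ∫₀ᵗ θ'` (`lfunctionTheta`, `θ' = ½ Re ψ((½ + a_χ + iu)/2) + ½ log(q/π)`) and `ξ(½ + it, χ)`
are the only transcendental quantities a certificate has to enclose.  Not here: any evaluator or checker (the
computational seat's job), and the complex characters (the pair form `of_turing_numeric` covers them).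

## References
* R. Rumely, Numerical computations concerning the ERH, Math. Comp. 61 (1993) 415–440: §2 p. 424 (rigorous
  sign determinations), §3 Proposition 3 p. 428 (Turing bound from F-points with alternating signs), §4 p. 433
  (the stored F-point data), p. 434 («replacing each `ρ` by the next smaller F-point»). [Rumely1993ERH]
* G. Hiary, S. Ireland, M. Kyi, Math. Comp. (2026), §4 Theorem 7 (sign-change hypotheses). [HiaryIrelandKyi2026]
* D. J. Platt, Math. Comp. 85 (2016), Theorem 3.2. [Platt2016GRH]
* T. S. Trudgian, Math. Comp. 80 (2011), Theorem 3.3 / §3.5 (the numerical Turing bound). [Trudgian2011]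
-/

noncomputable section

open Complex Set MeasureTheory intervalIntegral
open scoped Real ComplexConjugate

namespace Literature.NumberTheory.LFunctions

open DirichletCharacter ExplicitPsiChar DirichletTheta HiaryIrelandKyi2026 TrudgianNumerics

namespace TuringDirichlet

variable {q : ℕ} [NeZero q] {χ : DirichletCharacter ℂ q}

/-! ### Conjugation symmetry of the zeros of a real character -/

/-- A primitive character modulo `q > 1` is not the trivial character (its conductor is `q ≠ 1`). [folklore] -/
private theorem ne_one_of_isPrimitive_of_one_lt (hχ : χ.IsPrimitive) (hq : 1 < q) : χ ≠ 1 := by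
  rintro rfl
  have h : (1 : DirichletCharacter ℂ q).conductor = q := hχ
  rw [DirichletCharacter.conductor_one] at h
  omega

/-- **For a quadratic character the zeros of `L(s, χ)` are symmetric under complex conjugation**:
`L(s̄, χ) = 0 ↔ L(s, χ) = 0` (`conj L(s̄, χ) = L(s, χ̄)`, tree `DirichletZFR.conj_LFunction_conj`, and `χ̄ = χ`).
So for a real character zero data on the positive side of the critical line suffices (Rumely §3 p. 429:
`S(−t, χ) = −S(t, χ̄)`, and the lists of `L(s, χ)`, `L(s, χ̄)` coincide). [cite: Rumely1993ERH, §3 p. 429] -/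
theorem LFunction_conj_eq_zero_iff_of_isQuadratic (hχ2 : χ.IsQuadratic) (h1 : χ ≠ 1) (s : ℂ) :
    χ.LFunction (conj s) = 0 ↔ χ.LFunction s = 0 := by
  have h := DirichletZFR.conj_LFunction_conj χ h1 s
  rw [MulChar.IsQuadratic.inv hχ2] at h
  rw [← h, map_eq_zero]

/-- The point `½ − it` is the conjugate of `½ + it` (`t` real). [folklore] -/
private theorem half_add_neg_mul_I (t : ℝ) :
    (1 / 2 : ℂ) + ((-t : ℝ) : ℂ) * I = conj ((1 / 2 : ℂ) + (t : ℂ) * I) := by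
  apply Complex.ext <;> simp

/-- For a quadratic `χ`: `L(½ − it, χ) = 0 ↔ L(½ + it, χ) = 0`. [cite: Rumely1993ERH, §3 p. 429] -/
theorem LFunction_half_neg_eq_zero_iff_of_isQuadratic (hχ2 : χ.IsQuadratic) (h1 : χ ≠ 1) (t : ℝ) :
    χ.LFunction (1 / 2 + ((-t : ℝ) : ℂ) * I) = 0 ↔ χ.LFunction (1 / 2 + (t : ℂ) * I) = 0 := by
  rw [half_add_neg_mul_I, LFunction_conj_eq_zero_iff_of_isQuadratic hχ2 h1]

/-- For a quadratic `χ`, **a height `t` through no non-trivial zero is, with `−t`, through no non-trivial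
zero** (conjugation symmetry): the one-sided side condition of Turing's method gives the two-sided one of
`LFunctionRHUpTo.of_turing_numeric`. [cite: Rumely1993ERH, §3 p. 429] -/
theorem im_ne_neg_of_forall_im_ne (hχ2 : χ.IsQuadratic) (h1 : χ ≠ 1) {t : ℝ}
    (h : ∀ ρ ∈ charNontrivialZeros χ, ρ.im ≠ t) : ∀ ρ ∈ charNontrivialZeros χ, ρ.im ≠ t ∧ ρ.im ≠ -t := by
  intro ρ hρ
  refine ⟨h ρ hρ, fun hneg ↦ ?_⟩
  have hρ' : conj ρ ∈ charNontrivialZeros χ := by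
    rw [mem_charNontrivialZeros] at hρ ⊢
    exact ⟨(LFunction_conj_eq_zero_iff_of_isQuadratic hχ2 h1 ρ).2 hρ.1, by simpa using hρ.2.1,
      by simpa using hρ.2.2⟩
  exact h _ hρ' (by simp [Complex.conj_im, hneg])

/-! ### From sign-change data to distinct critical zeros -/

/-- **A selector of zeros for sign-change data**: if `ξ(½ + it, χ)` (real for quadratic primitive `χ`) changes
sign in each interval of `𝒵` (`IsSignChangeData χ τ 𝒵`), there is a choice `g` of a critical zero `½ + i g(P)` of
`L(s, χ)` in each `P = [γ₋, γ₊] ∈ 𝒵`, with `g(P) > 0` (IVT, `HiaryIrelandKyi2026.exists_zero_of_signChange`; `ξ = 0 ⇔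
L = 0` in the strip). This is the content of Rumely's phase II («rigorously separating the zeros and providing a
lower bound for the number of zeros on the line», p. 416). [cite: Rumely1993ERH, §2 p. 424] -/
theorem exists_zeroSelector (hχ : χ.IsPrimitive) (hχ2 : χ.IsQuadratic) (h1 : χ ≠ 1) {τ : ℝ}
    {Z : Finset (ℝ × ℝ)} (hZ : IsSignChangeData χ τ Z) :
    ∃ g : ℝ × ℝ → ℝ, ∀ P ∈ Z, g P ∈ Icc P.1 P.2 ∧ 0 < g P ∧ χ.LFunction (1 / 2 + (g P : ℂ) * I) = 0 := by
  classical
  have key : ∀ P ∈ Z, ∃ t ∈ Icc P.1 P.2, 0 < t ∧ χ.LFunction (1 / 2 + (t : ℂ) * I) = 0 := by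
    intro P hP
    obtain ⟨t, ht, ht0, hξ⟩ := exists_zero_of_signChange hχ hχ2 h1 (hZ.1 P hP).1 (hZ.2.2 P hP)
    refine ⟨t, ht, ht0, ?_⟩
    exact (mem_charNontrivialZeros.1
      ((dirichletXi_eq_zero_iff_mem_charNontrivialZeros hχ h1 _).1 hξ)).1
  refine ⟨fun P ↦ if hP : P ∈ Z then Classical.choose (key P hP) else 0, fun P hP ↦ ?_⟩
  simp only [dif_pos hP]
  obtain ⟨ht, ht0, hL⟩ := Classical.choose_spec (key P hP)
  exact ⟨ht, ht0, hL⟩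

/-- A selector for sign-change data is injective on the data (the intervals are pairwise disjoint), so it
selects `#𝒵` DISTINCT zeros. [cite: Rumely1993ERH, §2 p. 424] -/
theorem injOn_zeroSelector {τ : ℝ} {Z : Finset (ℝ × ℝ)} (hZ : IsSignChangeData χ τ Z) {g : ℝ × ℝ → ℝ}
    (hg : ∀ P ∈ Z, g P ∈ Icc P.1 P.2) : Set.InjOn g Z := by
  intro P hP Q hQ hPQ
  by_contra hne
  have hdisj := hZ.2.1 P hP Q hQ hne
  exact Set.disjoint_left.1 hdisj (hg P hP) (hPQ ▸ hg Q hQ)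

/-- **Sign-change data on `[0, T]` give `2·#𝒵` distinct critical zeros with `|γ| ≤ T`** (for a quadratic
primitive `χ`): the selected zeros `γ_P > 0`, `P ∈ 𝒵`, and their mirror images `−γ_P` (conjugation symmetry).
This is the lower half of the count sandwich: `2·#𝒵 ≤ N_{χ,0}(T)` (`card_le_lfunctionCriticalZeroCount`).
[cite: Rumely1993ERH, §2 p. 424] -/
theorem exists_criticalZeros_of_signChangeData (hχ : χ.IsPrimitive) (hχ2 : χ.IsQuadratic) (h1 : χ ≠ 1)
    {T : ℝ} {Z : Finset (ℝ × ℝ)} (hZ : IsSignChangeData χ T Z) :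
    ∃ W : Finset ℝ, W.card = 2 * Z.card ∧ ∀ γ ∈ W, χ.LFunction (1 / 2 + γ * I) = 0 ∧ |γ| ≤ T := by
  classical
  obtain ⟨g, hg⟩ := exists_zeroSelector hχ hχ2 h1 hZ
  have hinj : Set.InjOn g Z := injOn_zeroSelector hZ fun P hP ↦ (hg P hP).1
  set Wp : Finset ℝ := Z.image g with hWp
  set Wm : Finset ℝ := Wp.image (fun x : ℝ ↦ -x) with hWm
  have hWp_card : Wp.card = Z.card := Finset.card_image_of_injOn hinj
  have hWm_card : Wm.card = Z.card := by
    rw [hWm, Finset.card_image_of_injective _ neg_injective, hWp_card]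
  have hWp_pos : ∀ γ ∈ Wp, 0 < γ := by
    intro γ hγ
    obtain ⟨P, hP, rfl⟩ := Finset.mem_image.1 hγ
    exact (hg P hP).2.1
  have hWm_neg : ∀ γ ∈ Wm, γ < 0 := by
    intro γ hγ
    obtain ⟨x, hx, rfl⟩ := Finset.mem_image.1 hγ
    exact neg_lt_zero.2 (hWp_pos x hx)
  have hdisj : Disjoint Wp Wm :=
    Finset.disjoint_left.2 fun γ hγp hγm ↦ lt_irrefl _ ((hWm_neg γ hγm).trans (hWp_pos γ hγp))
  refine ⟨Wp ∪ Wm, by rw [Finset.card_union_of_disjoint hdisj, hWp_card, hWm_card]; ring, ?_⟩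
  intro γ hγ
  rcases Finset.mem_union.1 hγ with hγ | hγ
  · obtain ⟨P, hP, rfl⟩ := Finset.mem_image.1 hγ
    obtain ⟨hI, h0, hL⟩ := hg P hP
    exact ⟨hL, by rw [abs_of_pos h0]; exact hI.2.trans (hZ.1 P hP).2.2⟩
  · obtain ⟨x, hx, rfl⟩ := Finset.mem_image.1 hγ
    obtain ⟨P, hP, rfl⟩ := Finset.mem_image.1 hx
    obtain ⟨hI, h0, hL⟩ := hg P hP
    refine ⟨?_, by rw [abs_neg, abs_of_pos h0]; exact hI.2.trans (hZ.1 P hP).2.2⟩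
    have := (LFunction_half_neg_eq_zero_iff_of_isQuadratic hχ2 h1 (g P)).2 hL
    simpa using this

/-- Sign-change data to height `τ` are sign-change data to every height `τ' ≥ τ`.
[cite: HiaryIrelandKyi2026, §4 Theorem 7 (hypotheses)] -/
theorem _root_.Literature.NumberTheory.LFunctions.HiaryIrelandKyi2026.IsSignChangeData.mono_height {τ τ' : ℝ}
    {Z : Finset (ℝ × ℝ)} (h : IsSignChangeData χ τ Z) (hττ' : τ ≤ τ') : IsSignChangeData χ τ' Z :=
  ⟨fun P hP ↦ ⟨(h.1 P hP).1, (h.1 P hP).2.1, (h.1 P hP).2.2.trans hττ'⟩, h.2.1, h.2.2⟩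

/-! ### The schema -/

/-- **Turing's method for a real primitive character — found zeros below and above `T`** (the most general
form of the schema).  Let `χ` be a quadratic primitive character of conductor `q > 1`, `T > 50`, `h > 0`, with `T` and
`T + h` ordinates of no non-trivial zero; let `W` be `n` distinct ordinates `γ`, `|γ| ≤ T`, of critical zeros,
`Z` a finite set of ordinates of critical zeros in `(T, T + h]`, and `S ≤ Σ_{γ ∈ Z} (T + h − γ)` any certified lower
bound (e.g. from F-points above each zero, «replacing each `ρ` by the next F-point», Rumely p. 434).  If
`2(2.26 + 0.0642 log(q(T+h)/2π)) + (2/π)∫_T^{T+h} θ(t,χ)dt − 2S < h(n + 1)`, then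
`LFunctionRHUpTo χ T ∧ N_χ(T) = N_{χ,0}(T) = n` (`LFunctionRHUpTo.of_turing_numeric` with `Z' = Z`, `χ̄ = χ`;
the side conditions at `−T`, `−(T+h)` follow by conjugation symmetry).
[cite: Rumely1993ERH, §3 Proposition 3 p. 428] [cite: Platt2016GRH, Theorem 3.2] -/
theorem _root_.Literature.NumberTheory.LFunctions.LFunctionRHUpTo.of_turing_real
    (hcheck : trudgianCheck = true)
    (hχ : χ.IsPrimitive) (hχ2 : χ.IsQuadratic) (hq : 1 < q) {T h : ℝ} (hT : 50 < T) (hh : 0 < h)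
    (hz : ∀ ρ ∈ charNontrivialZeros χ, ρ.im ≠ T) (hzh : ∀ ρ ∈ charNontrivialZeros χ, ρ.im ≠ T + h)
    (W : Finset ℝ) (hW : ∀ γ ∈ W, χ.LFunction (1 / 2 + γ * I) = 0 ∧ |γ| ≤ T)
    (Z : Finset ℝ) (hZ : ∀ γ ∈ Z, χ.LFunction (1 / 2 + γ * I) = 0 ∧ T < γ ∧ γ ≤ T + h)
    {S : ℝ} (hS : S ≤ ∑ γ ∈ Z, (T + h - γ))
    (hnum : 2 * (2.26 + 0.0642 * Real.log (q * (T + h) / (2 * π))) +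
        2 / π * (∫ t in T..T + h, lfunctionTheta χ t) - 2 * S < h * (W.card + 1)) :
    LFunctionRHUpTo χ T ∧ lfunctionZeroCount χ T = W.card ∧ lfunctionCriticalZeroCount χ T = W.card := by
  have h1 : χ ≠ 1 := ne_one_of_isPrimitive_of_one_lt hχ hq
  have hZ' : ∀ γ ∈ Z, χ⁻¹.LFunction (1 / 2 + γ * I) = 0 ∧ T < γ ∧ γ ≤ T + h := by
    rw [MulChar.IsQuadratic.inv hχ2]; exact hZ
  have hnum' : 2 * (2.26 + 0.0642 * Real.log (q * (T + h) / (2 * π))) +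
      2 / π * (∫ t in T..T + h, lfunctionTheta χ t) - ∑ γ ∈ Z, (T + h - γ) - ∑ γ ∈ Z, (T + h - γ) <
      h * (W.card + 1) := by
    linarith
  exact LFunctionRHUpTo.of_turing_numeric hcheck hχ hq hT hh (im_ne_neg_of_forall_im_ne hχ2 h1 hz)
    (im_ne_neg_of_forall_im_ne hχ2 h1 hzh) W hW rfl Z hZ Z hZ' hnum'

/-- **Sign-change data above `T` select zeros in `(T, T + h]` with `Σ_P (T + h − b_P) ≤ Σ_γ (T + h − γ)`**
(each selected zero lies below the upper end of its interval). [cite: Rumely1993ERH, §4 p. 434] -/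
theorem exists_zerosAbove_of_signChangeData (hχ : χ.IsPrimitive) (hχ2 : χ.IsQuadratic) (h1 : χ ≠ 1)
    {T h : ℝ} {Z₂ : Finset (ℝ × ℝ)} (hZ₂ : IsSignChangeData χ (T + h) Z₂) (hZ₂T : ∀ P ∈ Z₂, T < P.1) :
    ∃ Z : Finset ℝ, (∀ γ ∈ Z, χ.LFunction (1 / 2 + γ * I) = 0 ∧ T < γ ∧ γ ≤ T + h) ∧
      ∑ P ∈ Z₂, (T + h - P.2) ≤ ∑ γ ∈ Z, (T + h - γ) := by
  classical
  obtain ⟨g₂, hg₂⟩ := exists_zeroSelector hχ hχ2 h1 hZ₂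
  have hinj₂ : Set.InjOn g₂ Z₂ := injOn_zeroSelector hZ₂ fun P hP ↦ (hg₂ P hP).1
  refine ⟨Z₂.image g₂, ?_, ?_⟩
  · intro γ hγ
    obtain ⟨P, hP, rfl⟩ := Finset.mem_image.1 hγ
    obtain ⟨hI, -, hL⟩ := hg₂ P hP
    exact ⟨hL, (hZ₂T P hP).trans_le hI.1, hI.2.trans (hZ₂.1 P hP).2.2⟩
  · rw [Finset.sum_image hinj₂]
    exact Finset.sum_le_sum fun P hP ↦ by linarith [(hg₂ P hP).1.2]

/-- **Turing's method for a real primitive character: found zeros below `T`, sign changes above** (the core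
form).  Let `χ` be a quadratic primitive character of conductor `q > 1`, `T > 50`, `h > 0`, with `T` and `T + h`
ordinates of no non-trivial zero; let `W` be `n` distinct ordinates `γ`, `|γ| ≤ T`, of critical zeros of
`L(s, χ)` (however obtained), and `𝒵₂` sign-change data whose intervals lie in `(T, T + h]`.  If
`2(2.26 + 0.0642 log(q(T+h)/2π)) + (2/π)∫_T^{T+h} θ(t,χ)dt − 2 Σ_{[a,b]∈𝒵₂} (T + h − b) < h(n + 1)` (each zero of
`(T, T+h]` replaced by the upper end of its interval, Rumely p. 434, which only weakens the left side), then
`LFunctionRHUpTo χ T ∧ N_χ(T) = N_{χ,0}(T) = n` (via `LFunctionRHUpTo.of_turing_numeric` with `Z' = Z`,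
`χ̄ = χ`, the side conditions at `−T`, `−(T+h)` following by conjugation symmetry).
[cite: Rumely1993ERH, §3 Proposition 3 p. 428] [cite: Platt2016GRH, Theorem 3.2] -/
theorem _root_.Literature.NumberTheory.LFunctions.LFunctionRHUpTo.of_turing_foundZeros
    (hcheck : trudgianCheck = true)
    (hχ : χ.IsPrimitive) (hχ2 : χ.IsQuadratic) (hq : 1 < q) {T h : ℝ} (hT : 50 < T) (hh : 0 < h)
    (hz : ∀ ρ ∈ charNontrivialZeros χ, ρ.im ≠ T) (hzh : ∀ ρ ∈ charNontrivialZeros χ, ρ.im ≠ T + h)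
    (W : Finset ℝ) (hW : ∀ γ ∈ W, χ.LFunction (1 / 2 + γ * I) = 0 ∧ |γ| ≤ T)
    {Z₂ : Finset (ℝ × ℝ)} (hZ₂ : IsSignChangeData χ (T + h) Z₂) (hZ₂T : ∀ P ∈ Z₂, T < P.1)
    (hnum : 2 * (2.26 + 0.0642 * Real.log (q * (T + h) / (2 * π))) +
        2 / π * (∫ t in T..T + h, lfunctionTheta χ t) - 2 * ∑ P ∈ Z₂, (T + h - P.2) <
        h * (W.card + 1)) :
    LFunctionRHUpTo χ T ∧ lfunctionZeroCount χ T = W.card ∧ lfunctionCriticalZeroCount χ T = W.card := by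
  have h1 : χ ≠ 1 := ne_one_of_isPrimitive_of_one_lt hχ hq
  obtain ⟨Z, hZ, hS⟩ := exists_zerosAbove_of_signChangeData hχ hχ2 h1 hZ₂ hZ₂T
  exact LFunctionRHUpTo.of_turing_real hcheck hχ hχ2 hq hT hh hz hzh W hW Z hZ hS hnum

/-- **Turing's method for a real primitive character from sign-change data** (the certificate schema).  Let `χ`
be a quadratic primitive character of conductor `q > 1`, `T > 50`, `h > 0`, with `T` and `T + h` ordinates of no
non-trivial zero of `L(s, χ)`.  Let `𝒵₁` be sign-change data on `[0, T]` (`m = #𝒵₁` disjoint intervals in each of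
which `ξ(½ + it, χ)` takes both signs) and `𝒵₂` sign-change data whose intervals lie in `(T, T + h]`.  If
`2(2.26 + 0.0642 log(q(T+h)/2π)) + (2/π)∫_T^{T+h} θ(t,χ)dt − 2 Σ_{[a,b]∈𝒵₂} (T + h − b) < h(2m + 1)`, then every
zero of `L(s, χ)` with `0 < Re s < 1`, `|Im s| ≤ T` lies on the critical line, and `N_χ(T) = N_{χ,0}(T) = 2m`
(the selected zeros `γ_P`, `P ∈ 𝒵₁`, and their negatives are `2m` distinct critical zeros with `|γ| ≤ T`;
`LFunctionRHUpTo.of_turing_foundZeros`).  This is Rumely's Proposition 3 / phase III in the tree's form (Platt's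
Thm. 3.2 inequality with Trudgian's numerical constants in place of Rumely's `B(Q, t)`).
[cite: Rumely1993ERH, §3 Proposition 3 p. 428] [cite: Platt2016GRH, Theorem 3.2] -/
theorem _root_.Literature.NumberTheory.LFunctions.LFunctionRHUpTo.of_turing_signChanges
    (hcheck : trudgianCheck = true)
    (hχ : χ.IsPrimitive) (hχ2 : χ.IsQuadratic) (hq : 1 < q) {T h : ℝ} (hT : 50 < T) (hh : 0 < h)
    (hz : ∀ ρ ∈ charNontrivialZeros χ, ρ.im ≠ T) (hzh : ∀ ρ ∈ charNontrivialZeros χ, ρ.im ≠ T + h)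
    {Z₁ : Finset (ℝ × ℝ)} (hZ₁ : IsSignChangeData χ T Z₁)
    {Z₂ : Finset (ℝ × ℝ)} (hZ₂ : IsSignChangeData χ (T + h) Z₂) (hZ₂T : ∀ P ∈ Z₂, T < P.1)
    (hnum : 2 * (2.26 + 0.0642 * Real.log (q * (T + h) / (2 * π))) +
        2 / π * (∫ t in T..T + h, lfunctionTheta χ t) - 2 * ∑ P ∈ Z₂, (T + h - P.2) <
        h * (2 * Z₁.card + 1)) :
    LFunctionRHUpTo χ T ∧ lfunctionZeroCount χ T = 2 * Z₁.card ∧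
      lfunctionCriticalZeroCount χ T = 2 * Z₁.card := by
  have h1 : χ ≠ 1 := ne_one_of_isPrimitive_of_one_lt hχ hq
  obtain ⟨W, hWn, hW⟩ := exists_criticalZeros_of_signChangeData hχ hχ2 h1 hZ₁
  rw [← hWn]
  refine LFunctionRHUpTo.of_turing_foundZeros hcheck hχ hχ2 hq hT hh hz hzh W hW hZ₂ hZ₂T ?_
  rw [hWn]; push_cast; exact hnum

/-! ### Removing the non-ordinate side conditions

A certificate cannot check that the heights `T`, `T + h` carry no zero OFF the line; but the conclusion at `T`
follows from the schema at perturbed heights `T' ∈ (T, T + η)`, `U' ∈ (T + h − η, T + h)` through no zero (all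
but finitely many heights qualify), and the strict inequality survives a small perturbation.  So the two side
conditions can be dropped (Rumely §3 p. 426: «Even if `t₁` or `t₂` is the ordinate of a zero, the ERH can still be
established …»). -/

/-- `N_χ(T)` is monotone in `T` (a larger box). [cite: Platt2016GRH, Theorem 3.2] -/
theorem lfunctionZeroCount_mono (h1 : χ ≠ 1) {T T' : ℝ} (hTT' : T ≤ T') :
    lfunctionZeroCount χ T ≤ lfunctionZeroCount χ T' := by
  have hA' : (lfunctionZeroBox χ T').Finite := lfunctionZeroBox_finite h1 T'
  have hsub : lfunctionZeroBox χ T ⊆ lfunctionZeroBox χ T' := fun ρ hρ ↦ by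
    obtain ⟨hL, h0, h1', hT⟩ := mem_lfunctionZeroBox.1 hρ
    exact mem_lfunctionZeroBox.2 ⟨hL, h0, h1', hT.trans hTT'⟩
  have hA : (lfunctionZeroBox χ T).Finite := hA'.subset hsub
  unfold lfunctionZeroCount
  rw [finsum_mem_eq_finite_toFinset_sum _ hA, finsum_mem_eq_finite_toFinset_sum _ hA']
  exact Finset.sum_le_sum_of_subset ((Set.Finite.toFinset_subset_toFinset).2 hsub)

/-- **All but finitely many heights are ordinates of no zero**: every open interval `(a, b) ⊆ [−R, R]` contains a
height through no non-trivial zero of `L(s, χ)` (the zeros with `|Im ρ| ≤ R` are finite in number, `χ ≠ χ₀`).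
[cite: MontgomeryVaughan2007, Corollary 10.8] -/
theorem exists_nonOrdinate (h1 : χ ≠ 1) {a b R : ℝ} (hab : a < b) (hbR : b ≤ R) (haR : -R ≤ a) :
    ∃ x ∈ Ioo a b, ∀ ρ ∈ charNontrivialZeros χ, ρ.im ≠ x := by
  have hfin : (Complex.im '' lfunctionZeroBox χ R).Finite := (lfunctionZeroBox_finite h1 R).image _
  obtain ⟨x, hx, hxF⟩ := ((Set.Ioo_infinite hab).sdiff hfin).nonempty
  refine ⟨x, hx, fun ρ hρ hρx ↦ hxF ⟨ρ, ?_, hρx⟩⟩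
  rw [mem_charNontrivialZeros] at hρ
  refine mem_lfunctionZeroBox.2 ⟨hρ.1, hρ.2.1, hρ.2.2, ?_⟩
  rw [hρx, abs_le]
  exact ⟨by linarith [hx.1], by linarith [hx.2]⟩

/-- **Turing's method for a real primitive character — found zeros below and above `T`, with NO side condition
on the heights** (the most general form in final shape).  Hypotheses as in `LFunctionRHUpTo.of_turing_real`
without `T`, `T + h` being non-ordinates.  Proof: apply `of_turing_real` at heights `T' ∈ (T, T + η)`,
`U' ∈ (T + h − η, T + h)` through no zero (`exists_nonOrdinate`: all but finitely many heights qualify), with `η`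
below the slack of the strict inequality divided by `2 sup_{[T,T+h]}|θ| + 2#Z + 2n + 3` and below the gaps
`γ − T`, `T + h − γ` of the data (zeros at exactly `T + h` contribute `0` and are dropped); then
`N_χ(T) ≤ N_χ(T') = n ≤ N_{χ,0}(T)` and the count sandwich (Rumely p. 426: «Even if `t₁` or `t₂` is the ordinate
of a zero, the ERH can still be established»).
[cite: Rumely1993ERH, §3 Proposition 3 p. 428 and p. 426] [cite: Platt2016GRH, Theorem 3.2] -/
theorem _root_.Literature.NumberTheory.LFunctions.LFunctionRHUpTo.of_turing_real'
    (hcheck : trudgianCheck = true)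
    (hχ : χ.IsPrimitive) (hχ2 : χ.IsQuadratic) (hq : 1 < q) {T h : ℝ} (hT : 50 < T) (hh : 0 < h)
    (W : Finset ℝ) (hW : ∀ γ ∈ W, χ.LFunction (1 / 2 + γ * I) = 0 ∧ |γ| ≤ T)
    (Z : Finset ℝ) (hZ : ∀ γ ∈ Z, χ.LFunction (1 / 2 + γ * I) = 0 ∧ T < γ ∧ γ ≤ T + h)
    {S : ℝ} (hS : S ≤ ∑ γ ∈ Z, (T + h - γ))
    (hnum : 2 * (2.26 + 0.0642 * Real.log (q * (T + h) / (2 * π))) +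
        2 / π * (∫ t in T..T + h, lfunctionTheta χ t) - 2 * S < h * (W.card + 1)) :
    LFunctionRHUpTo χ T ∧ lfunctionZeroCount χ T = W.card ∧ lfunctionCriticalZeroCount χ T = W.card := by
  classical
  have h1 : χ ≠ 1 := ne_one_of_isPrimitive_of_one_lt hχ hq
  -- the zeros of `Z` not at the top height (the others contribute `0` to the sum)
  set Zf : Finset ℝ := Z.filter (fun γ ↦ γ < T + h) with hZf_def
  have hZf_sub : ∀ γ ∈ Zf, γ ∈ Z := fun γ hγ ↦ (Finset.mem_filter.1 hγ).1
  have hsumZ : ∑ γ ∈ Z, (T + h - γ) = ∑ γ ∈ Zf, (T + h - γ) := by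
    rw [← Finset.sum_filter_add_sum_filter_not Z (fun γ ↦ γ < T + h)]
    have h0 : ∑ γ ∈ Z with ¬ γ < T + h, (T + h - γ) = 0 :=
      Finset.sum_eq_zero fun γ hγ ↦ by
        obtain ⟨hγ, hnot⟩ := Finset.mem_filter.1 hγ
        have := (hZ γ hγ).2.2
        linarith [not_lt.1 hnot]
    rw [h0, add_zero]
  -- a bound for `|θ|` on `[T, T + h]`
  obtain ⟨M₀, hM₀⟩ := (isCompact_Icc (a := T) (b := T + h)).exists_bound_of_continuousOn
    (continuous_lfunctionTheta χ).continuousOn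
  set M : ℝ := max M₀ 0 with hM_def
  have hM0 : 0 ≤ M := le_max_right _ _
  have hM : ∀ x ∈ Icc T (T + h), |lfunctionTheta χ x| ≤ M := fun x hx ↦ by
    have h := hM₀ x hx
    rw [Real.norm_eq_abs] at h
    exact h.trans (le_max_left _ _)
  -- the slack and the size of the perturbation
  set n : ℕ := W.card with hn_def
  set k : ℕ := Zf.card with hk_def
  set L₀ : ℝ := 2 * (2.26 + 0.0642 * Real.log (q * (T + h) / (2 * π))) +
    2 / π * (∫ t in T..T + h, lfunctionTheta χ t) - 2 * S with hL₀_def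
  set s : ℝ := h * (n + 1) - L₀ with hs_def
  have hs : 0 < s := by rw [hs_def]; linarith
  set D : ℝ := 2 * M + 2 * k + 2 * n + 3 with hD_def
  have hD : 0 < D := by positivity
  set η₀ : ℝ := s / D / 2 with hη₀_def
  have hη₀ : 0 < η₀ := by positivity
  have hη₀D : η₀ * D < s := by
    have : η₀ * D = s / 2 := by rw [hη₀_def]; field_simp
    rw [this]; linarith
  -- `η`: below `η₀`, `h/4`, and the gaps of the data
  set G : Finset ℝ := insert η₀ (insert (h / 4)
    ((Z.image fun γ ↦ γ - T) ∪ (Zf.image fun γ ↦ T + h - γ))) with hG_def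
  have hGpos : ∀ x ∈ G, 0 < x := by
    intro x hx
    rcases Finset.mem_insert.1 hx with rfl | hx
    · exact hη₀
    rcases Finset.mem_insert.1 hx with rfl | hx
    · positivity
    rcases Finset.mem_union.1 hx with hx | hx
    · obtain ⟨γ, hγ, rfl⟩ := Finset.mem_image.1 hx
      linarith [(hZ γ hγ).2.1]
    · obtain ⟨γ, hγ, rfl⟩ := Finset.mem_image.1 hx
      linarith [(Finset.mem_filter.1 hγ).2]
  have hη₀G : η₀ ∈ G := Finset.mem_insert_self _ _
  set η : ℝ := G.min' ⟨η₀, hη₀G⟩ with hη_def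
  have hηpos : 0 < η := hGpos _ (Finset.min'_mem G _)
  have hηle : ∀ x ∈ G, η ≤ x := fun x hx ↦ Finset.min'_le G x hx
  have hηη₀ : η ≤ η₀ := hηle _ hη₀G
  have hηh : η ≤ h / 4 := hηle _ (Finset.mem_insert_of_mem (Finset.mem_insert_self _ _))
  have hη1 : ∀ γ ∈ Z, η ≤ γ - T := fun γ hγ ↦ hηle _
    (Finset.mem_insert_of_mem (Finset.mem_insert_of_mem
      (Finset.mem_union_left _ (Finset.mem_image_of_mem _ hγ))))
  have hη2 : ∀ γ ∈ Zf, η ≤ T + h - γ := fun γ hγ ↦ hηle _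
    (Finset.mem_insert_of_mem (Finset.mem_insert_of_mem
      (Finset.mem_union_right _ (Finset.mem_image_of_mem _ hγ))))
  -- the perturbed heights, through no zero
  obtain ⟨T', hT'I, hT'z⟩ := exists_nonOrdinate (χ := χ) h1 (a := T) (b := T + η) (R := T + h + 1)
    (by linarith) (by linarith) (by linarith)
  obtain ⟨U', hU'I, hU'z⟩ := exists_nonOrdinate (χ := χ) h1 (a := T + h - η) (b := T + h) (R := T + h + 1)
    (by linarith) (by linarith) (by linarith)
  set h' : ℝ := U' - T' with hh'_def
  have hTU : T' + h' = U' := by rw [hh'_def]; ring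
  have hh' : 0 < h' := by rw [hh'_def]; linarith [hT'I.2, hU'I.1]
  have hT' : 50 < T' := hT.trans hT'I.1
  -- the data at the perturbed heights
  have hW' : ∀ γ ∈ W, χ.LFunction (1 / 2 + γ * I) = 0 ∧ |γ| ≤ T' := fun γ hγ ↦
    ⟨(hW γ hγ).1, (hW γ hγ).2.trans hT'I.1.le⟩
  have hZf' : ∀ γ ∈ Zf, χ.LFunction (1 / 2 + γ * I) = 0 ∧ T' < γ ∧ γ ≤ T' + h' := by
    rw [hTU]
    intro γ hγ
    exact ⟨(hZ γ (hZf_sub γ hγ)).1, by linarith [hη1 γ (hZf_sub γ hγ), hT'I.2],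
      by linarith [hη2 γ hγ, hU'I.1]⟩
  have hzh' : ∀ ρ ∈ charNontrivialZeros χ, ρ.im ≠ T' + h' := by rw [hTU]; exact hU'z
  -- the perturbed inequality: (i) the logarithm
  have hU'pos : 0 < U' := by linarith [hU'I.1]
  have hq0 : (0 : ℝ) < q := by exact_mod_cast (zero_lt_one.trans hq)
  have hlog : Real.log (q * (T' + h') / (2 * π)) ≤ Real.log (q * (T + h) / (2 * π)) := by
    rw [hTU]
    exact Real.log_le_log (by positivity) (by gcongr; exact hU'I.2.le)
  -- (ii) the integral of `θ`
  have hii : ∀ a b : ℝ, IntervalIntegrable (lfunctionTheta χ) MeasureTheory.volume a b := fun a b ↦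
    (continuous_lfunctionTheta χ).intervalIntegrable a b
  have hsplit : ∫ t in T'..U', lfunctionTheta χ t = (∫ t in T..T + h, lfunctionTheta χ t) -
      (∫ t in T..T', lfunctionTheta χ t) - ∫ t in U'..T + h, lfunctionTheta χ t := by
    have h12 := integral_add_adjacent_intervals (hii T T') (hii T' U')
    have h23 := integral_add_adjacent_intervals (hii T U') (hii U' (T + h))
    linarith
  have hb1 : |∫ t in T..T', lfunctionTheta χ t| ≤ M * (T' - T) := by
    have h := intervalIntegral.norm_integral_le_of_norm_le_const (a := T) (b := T') (C := M)
      (f := lfunctionTheta χ) ?_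
    · rw [Real.norm_eq_abs, abs_of_pos (sub_pos.2 hT'I.1)] at h
      exact h
    · intro x hx
      rw [Set.uIoc_of_le hT'I.1.le] at hx
      rw [Real.norm_eq_abs]
      exact hM x ⟨hx.1.le, by linarith [hx.2, hT'I.2]⟩
  have hb2 : |∫ t in U'..T + h, lfunctionTheta χ t| ≤ M * (T + h - U') := by
    have h := intervalIntegral.norm_integral_le_of_norm_le_const (a := U') (b := T + h) (C := M)
      (f := lfunctionTheta χ) ?_
    · rw [Real.norm_eq_abs, abs_of_pos (sub_pos.2 hU'I.2)] at h
      exact h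
    · intro x hx
      rw [Set.uIoc_of_le hU'I.2.le] at hx
      rw [Real.norm_eq_abs]
      exact hM x ⟨by linarith [hx.1, hU'I.1], hx.2⟩
  have hπ : 2 / π ≤ 1 := by rw [div_le_one Real.pi_pos]; exact Real.two_le_pi
  have hπ0 : 0 < 2 / π := by positivity
  have hI : 2 / π * (∫ t in T'..T' + h', lfunctionTheta χ t) ≤
      2 / π * (∫ t in T..T + h, lfunctionTheta χ t) + (M * (T' - T) + M * (T + h - U')) := by
    rw [hTU, hsplit]
    obtain ⟨h1a, h1b⟩ := abs_le.1 hb1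
    obtain ⟨h2a, h2b⟩ := abs_le.1 hb2
    have hle : -(∫ t in T..T', lfunctionTheta χ t) - (∫ t in U'..T + h, lfunctionTheta χ t) ≤
        M * (T' - T) + M * (T + h - U') := by linarith
    have hstep : 2 / π * (-(∫ t in T..T', lfunctionTheta χ t) - ∫ t in U'..T + h, lfunctionTheta χ t) ≤
        1 * (M * (T' - T) + M * (T + h - U')) :=
      (mul_le_mul_of_nonneg_left hle hπ0.le).trans
        (mul_le_mul_of_nonneg_right hπ (by nlinarith [hT'I.1, hU'I.2]))
    linarith
  -- (iii) the sum over the zeros above `T`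
  have hsum' : ∑ γ ∈ Zf, (T' + h' - γ) = ∑ γ ∈ Zf, (T + h - γ) - (T + h - U') * k := by
    rw [hTU, hk_def]
    have hc : ∀ γ ∈ Zf, U' - γ = (T + h - γ) - (T + h - U') := fun γ _ ↦ by ring
    rw [Finset.sum_congr rfl hc, Finset.sum_sub_distrib, Finset.sum_const, nsmul_eq_mul]
    ring
  have hS' : S - (T + h - U') * (k : ℝ) ≤ ∑ γ ∈ Zf, (T' + h' - γ) := by rw [hsum', ← hsumZ]; linarith
  -- (iv) assemble
  have hε : T' - T < η := by linarith [hT'I.2]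
  have hδ : T + h - U' < η := by linarith [hU'I.1]
  have hk0 : (0 : ℝ) ≤ k := Nat.cast_nonneg _
  have hn0 : (0 : ℝ) ≤ n := Nat.cast_nonneg _
  have hnum' : 2 * (2.26 + 0.0642 * Real.log (q * (T' + h') / (2 * π))) +
      2 / π * (∫ t in T'..T' + h', lfunctionTheta χ t) - 2 * (S - (T + h - U') * (k : ℝ)) <
      h' * (W.card + 1) := by
    have e1 : M * (T' - T) ≤ M * η := mul_le_mul_of_nonneg_left hε.le hM0
    have e2 : M * (T + h - U') ≤ M * η := mul_le_mul_of_nonneg_left hδ.le hM0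
    have e3 : (T + h - U') * k ≤ η * k := mul_le_mul_of_nonneg_right hδ.le hk0
    have e4 : η * D ≤ η₀ * D := mul_le_mul_of_nonneg_right hηη₀ hD.le
    have e5 : (T' - T) * n ≤ η * n := mul_le_mul_of_nonneg_right hε.le hn0
    have e6 : (T + h - U') * n ≤ η * n := mul_le_mul_of_nonneg_right hδ.le hn0
    have hDη : η * D = 2 * (M * η) + 2 * (η * k) + 2 * (η * n) + 3 * η := by rw [hD_def]; ring
    have hRHS : h' * ((W.card : ℝ) + 1) = h * ((n : ℝ) + 1) - (T' - T) * n - (T' - T) -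
        (T + h - U') * n - (T + h - U') := by
      rw [hh'_def, hn_def]; ring
    rw [hRHS]
    linarith [hlog, hI, e1, e2, e3, e4, e5, e6, hη₀D, hηpos, hDη, hs, hs_def, hL₀_def, hnum, hε, hδ,
      hk0, hn0, hM0]
  -- the schema at the perturbed heights, then back to `T`
  obtain ⟨-, hN', -⟩ := LFunctionRHUpTo.of_turing_real hcheck hχ hχ2 hq hT' hh' hT'z hzh' W hW' Zf hZf'
    hS' hnum'
  have hlow : W.card ≤ lfunctionCriticalZeroCount χ T := card_le_lfunctionCriticalZeroCount h1 W hW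
  have hup : lfunctionZeroCount χ T ≤ W.card := (lfunctionZeroCount_mono h1 hT'I.1.le).trans hN'.le
  exact LFunctionRHUpTo.of_count_sandwich h1 hup hlow

/-- **Turing's method for a real primitive character, found zeros below `T`, with NO side condition on the
heights** (the core form in final shape).  Let `χ` be a quadratic primitive character of conductor `q > 1`,
`T > 50`, `h > 0`; let `W` be `n` distinct ordinates `γ`, `|γ| ≤ T`, of critical zeros, and `𝒵₂` sign-change
data with intervals inside `(T, T + h]`.  If
`2(2.26 + 0.0642 log(q(T+h)/2π)) + (2/π)∫_T^{T+h} θ(t,χ)dt − 2 Σ_{[a,b]∈𝒵₂} (T + h − b) < h(n + 1)`,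
then `LFunctionRHUpTo χ T` and `N_χ(T) = N_{χ,0}(T) = n` (`LFunctionRHUpTo.of_turing_real'` with the zeros selected
by `𝒵₂`, `exists_zerosAbove_of_signChangeData`).
[cite: Rumely1993ERH, §3 Proposition 3 p. 428 and p. 426] [cite: Platt2016GRH, Theorem 3.2] -/
theorem _root_.Literature.NumberTheory.LFunctions.LFunctionRHUpTo.of_turing_foundZeros'
    (hcheck : trudgianCheck = true)
    (hχ : χ.IsPrimitive) (hχ2 : χ.IsQuadratic) (hq : 1 < q) {T h : ℝ} (hT : 50 < T) (hh : 0 < h)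
    (W : Finset ℝ) (hW : ∀ γ ∈ W, χ.LFunction (1 / 2 + γ * I) = 0 ∧ |γ| ≤ T)
    {Z₂ : Finset (ℝ × ℝ)} (hZ₂ : IsSignChangeData χ (T + h) Z₂) (hZ₂T : ∀ P ∈ Z₂, T < P.1)
    (hnum : 2 * (2.26 + 0.0642 * Real.log (q * (T + h) / (2 * π))) +
        2 / π * (∫ t in T..T + h, lfunctionTheta χ t) - 2 * ∑ P ∈ Z₂, (T + h - P.2) <
        h * (W.card + 1)) :
    LFunctionRHUpTo χ T ∧ lfunctionZeroCount χ T = W.card ∧ lfunctionCriticalZeroCount χ T = W.card := by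
  have h1 : χ ≠ 1 := ne_one_of_isPrimitive_of_one_lt hχ hq
  obtain ⟨Z, hZ, hS⟩ := exists_zerosAbove_of_signChangeData hχ hχ2 h1 hZ₂ hZ₂T
  exact LFunctionRHUpTo.of_turing_real' hcheck hχ hχ2 hq hT hh W hW Z hZ hS hnum

/-- **Turing's method for a real primitive character from sign-change data, with NO side condition on the
heights** (the certificate schema in final form).  Let `χ` be a quadratic primitive character of conductor
`q > 1`, `T > 50`, `h > 0`; let `𝒵₁` be sign-change data on `[0, T]` (`m = #𝒵₁`) and `𝒵₂` sign-change data with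
intervals inside `(T, T + h]`.  If
`2(2.26 + 0.0642 log(q(T+h)/2π)) + (2/π)∫_T^{T+h} θ(t,χ)dt − 2 Σ_{[a,b]∈𝒵₂} (T + h − b) < h(2m + 1)`,
then `LFunctionRHUpTo χ T` and `N_χ(T) = N_{χ,0}(T) = 2m` (`LFunctionRHUpTo.of_turing_foundZeros'` with the
`2m` zeros of `exists_criticalZeros_of_signChangeData`; Rumely p. 426: «Even if `t₁` or `t₂` is the ordinate of a
zero, the ERH can still be established»).  So a certificate consists of: the sign-change data (enclosures of the
real values `ξ(½ + it, χ)` at finitely many points), an enclosure of `∫_T^{T+h} θ`, and one decimal comparison.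
[cite: Rumely1993ERH, §3 Proposition 3 p. 428 and p. 426] [cite: Platt2016GRH, Theorem 3.2] -/
theorem _root_.Literature.NumberTheory.LFunctions.LFunctionRHUpTo.of_turing_signChanges'
    (hcheck : trudgianCheck = true)
    (hχ : χ.IsPrimitive) (hχ2 : χ.IsQuadratic) (hq : 1 < q) {T h : ℝ} (hT : 50 < T) (hh : 0 < h)
    {Z₁ : Finset (ℝ × ℝ)} (hZ₁ : IsSignChangeData χ T Z₁)
    {Z₂ : Finset (ℝ × ℝ)} (hZ₂ : IsSignChangeData χ (T + h) Z₂) (hZ₂T : ∀ P ∈ Z₂, T < P.1)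
    (hnum : 2 * (2.26 + 0.0642 * Real.log (q * (T + h) / (2 * π))) +
        2 / π * (∫ t in T..T + h, lfunctionTheta χ t) - 2 * ∑ P ∈ Z₂, (T + h - P.2) <
        h * (2 * Z₁.card + 1)) :
    LFunctionRHUpTo χ T ∧ lfunctionZeroCount χ T = 2 * Z₁.card ∧
      lfunctionCriticalZeroCount χ T = 2 * Z₁.card := by
  have h1 : χ ≠ 1 := ne_one_of_isPrimitive_of_one_lt hχ hq
  obtain ⟨W, hWn, hW⟩ := exists_criticalZeros_of_signChangeData hχ hχ2 h1 hZ₁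
  rw [← hWn]
  refine LFunctionRHUpTo.of_turing_foundZeros' hcheck hχ hχ2 hq hT hh W hW hZ₂ hZ₂T ?_
  rw [hWn]; push_cast; exact hnum


/-! ### Rumely's own format: F-points with alternating signs

Proposition 3 (p. 428): «points `50 < t₀ < t₁ < ⋯ < t_m` … such that the values `Z(t_i, χ)` are alternating in
sign».  Consecutive F-points bound CLOSED intervals sharing endpoints, so this is not literally
`IsSignChangeData` (pairwise disjoint closed intervals); but `ξ(½ + it_i, χ) ≠ 0`, so the zero of each
`[t_{i−1}, t_i]` is interior and the `m` zeros are distinct.  We read `Z` through the tree's real function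
`t ↦ Re ξ(½ + it, χ)` (same sign changes as Hardy's `Z(t, χ)`: `ξ(½ + it, χ) = (q/π)^{(s+κ)/2} Γ((s+κ)/2)·L`,
and `Z = e^{iθ}L` with the same zero set on the line). -/

/-- A chain `t₀ < t₁ < ⋯ < t_m` is monotone: `t_i ≤ t_j` for `i ≤ j ≤ m`. [folklore] -/
private theorem le_of_chain {m : ℕ} {t : ℕ → ℝ} (hmono : ∀ i < m, t i < t (i + 1)) :
    ∀ i j, i ≤ j → j ≤ m → t i ≤ t j := by
  intro i j hij hjm
  induction j with
  | zero => simp [Nat.le_zero.1 hij]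
  | succ j ih =>
    rcases Nat.lt_or_eq_of_le hij with h | h
    · exact (ih (Nat.lt_succ_iff.1 h) (by omega)).trans (hmono j (by omega)).le
    · rw [h]

/-- **A zero selector for an alternating F-point list** (real primitive `χ`): if `0 ≤ t₀ < t₁ < ⋯ < t_m` and
`Re ξ(½ + it_{i−1}, χ)·Re ξ(½ + it_i, χ) < 0` for `i = 1..m`, there are critical zeros `½ + iγ_i` of `L(s, χ)` with
`t_{i−1} < γ_i < t_i` (IVT; the endpoints are not zeros, so each zero is interior), hence pairwise distinct — Rumely's
phase II («at least as many zeros on the line as claimed», p. 424; Proposition 3's «`Z(t_i, χ)` alternating in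
sign», p. 428). [cite: Rumely1993ERH, §3 Proposition 3 p. 428] -/
theorem exists_selector_of_alternating (hχ : χ.IsPrimitive) (hχ2 : χ.IsQuadratic) (h1 : χ ≠ 1)
    {m : ℕ} {t : ℕ → ℝ} (ht0 : 0 ≤ t 0) (hmono : ∀ i < m, t i < t (i + 1))
    (halt : ∀ i < m, (dirichletXi χ (1 / 2 + t i * I)).re * (dirichletXi χ (1 / 2 + t (i + 1) * I)).re < 0) :
    ∃ g : ℕ → ℝ, (∀ i < m, g i ∈ Ioo (t i) (t (i + 1)) ∧ χ.LFunction (1 / 2 + (g i : ℂ) * I) = 0) ∧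
      Set.InjOn g (Finset.range m) := by
  classical
  have hmono' := le_of_chain hmono
  -- one interior zero per gap
  have key : ∀ i < m, ∃ γ ∈ Ioo (t i) (t (i + 1)), χ.LFunction (1 / 2 + (γ : ℂ) * I) = 0 := by
    intro i hi
    have hprod := halt i hi
    have hti0 : 0 ≤ t i := ht0.trans (hmono' 0 i (Nat.zero_le _) hi.le)
    -- a sign change on `[t i, t (i+1)]` in HIK's form
    have hsc : ∃ τ₁ ∈ Icc (t i) (t (i + 1)), ∃ τ₂ ∈ Icc (t i) (t (i + 1)),
        (dirichletXi χ (1 / 2 + τ₁ * I)).re < 0 ∧ 0 < (dirichletXi χ (1 / 2 + τ₂ * I)).re := by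
      have hle : t i ≤ t (i + 1) := (hmono i hi).le
      rcases lt_or_gt_of_ne (show (dirichletXi χ (1 / 2 + t i * I)).re ≠ 0 from
        fun h ↦ by rw [h, zero_mul] at hprod; exact lt_irrefl _ hprod) with hneg | hpos
      · have hpos' : 0 < (dirichletXi χ (1 / 2 + t (i + 1) * I)).re := by
          by_contra hle'
          exact absurd hprod (not_lt.2 (mul_nonneg_of_nonpos_of_nonpos hneg.le (not_lt.1 hle')))
        exact ⟨t i, left_mem_Icc.2 hle, t (i + 1), right_mem_Icc.2 hle, hneg, hpos'⟩
      · have hneg' : (dirichletXi χ (1 / 2 + t (i + 1) * I)).re < 0 := by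
          by_contra hle'
          exact absurd hprod (not_lt.2 (mul_nonneg hpos.le (not_lt.1 hle')))
        exact ⟨t (i + 1), right_mem_Icc.2 hle, t i, left_mem_Icc.2 hle, hneg', hpos⟩
    obtain ⟨γ, hγI, -, hγ0⟩ := exists_zero_of_signChange hχ hχ2 h1 (P := (t i, t (i + 1))) hti0 hsc
    have hγL : χ.LFunction (1 / 2 + (γ : ℂ) * I) = 0 :=
      (mem_charNontrivialZeros.1 ((dirichletXi_eq_zero_iff_mem_charNontrivialZeros hχ h1 _).1 hγ0)).1
    -- the zero is interior: the endpoints are not zeros of `ξ`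
    have hne1 : γ ≠ t i := fun h ↦ by
      rw [h] at hγ0; rw [hγ0, Complex.zero_re, zero_mul] at hprod; exact lt_irrefl _ hprod
    have hne2 : γ ≠ t (i + 1) := fun h ↦ by
      rw [h] at hγ0; rw [hγ0, Complex.zero_re, mul_zero] at hprod; exact lt_irrefl _ hprod
    exact ⟨γ, ⟨lt_of_le_of_ne hγI.1 (Ne.symm hne1), lt_of_le_of_ne hγI.2 hne2⟩, hγL⟩
  -- a selector, strictly increasing
  refine ⟨fun i ↦ if hi : i < m then Classical.choose (key i hi) else 0, fun i hi ↦ ?_, ?_⟩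
  · simp only [dif_pos hi]
    obtain ⟨hI, hL⟩ := Classical.choose_spec (key i hi)
    exact ⟨hI, hL⟩
  · intro i hi j hj hij
    simp only [Finset.coe_range, Set.mem_Iio] at hi hj
    simp only [dif_pos hi, dif_pos hj] at hij
    have hgi := (Classical.choose_spec (key i hi)).1
    have hgj := (Classical.choose_spec (key j hj)).1
    by_contra hne
    rcases lt_or_gt_of_ne hne with hlt | hlt
    · have := hgi.2.trans_le ((hmono' (i + 1) j hlt hj.le).trans hgj.1.le)
      rw [hij] at this; exact lt_irrefl _ this
    · have := hgj.2.trans_le ((hmono' (j + 1) i hlt hi.le).trans hgi.1.le)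
      rw [hij] at this; exact lt_irrefl _ this

/-- **F-points with alternating signs give `2m` distinct critical zeros with `|γ| ≤ T`** (real primitive `χ`):
if `0 ≤ t₀ < t₁ < ⋯ < t_m ≤ T` and `Re ξ(½ + it_{i−1}, χ) · Re ξ(½ + it_i, χ) < 0` for `i = 1..m`, then there are
zeros `½ ± iγ_i`, `t_{i−1} < γ_i < t_i`, all distinct — Rumely's phase II count («at least as many zeros on the
line as claimed», p. 424), doubled by conjugation symmetry. [cite: Rumely1993ERH, §3 Proposition 3 p. 428] -/
theorem exists_criticalZeros_of_alternating (hχ : χ.IsPrimitive) (hχ2 : χ.IsQuadratic) (h1 : χ ≠ 1)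
    {m : ℕ} {t : ℕ → ℝ} (ht0 : 0 ≤ t 0) (hmono : ∀ i < m, t i < t (i + 1))
    (halt : ∀ i < m, (dirichletXi χ (1 / 2 + t i * I)).re * (dirichletXi χ (1 / 2 + t (i + 1) * I)).re < 0)
    {T : ℝ} (htm : t m ≤ T) :
    ∃ W : Finset ℝ, W.card = 2 * m ∧ ∀ γ ∈ W, χ.LFunction (1 / 2 + γ * I) = 0 ∧ |γ| ≤ T := by
  classical
  have hmono' := le_of_chain hmono
  obtain ⟨g, hg, hg_inj⟩ := exists_selector_of_alternating hχ hχ2 h1 ht0 hmono halt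
  have hg_pos : ∀ i < m, 0 < g i := fun i hi ↦
    (ht0.trans (hmono' 0 i (Nat.zero_le _) hi.le)).trans_lt (hg i hi).1.1
  have hg_le : ∀ i < m, g i ≤ T := fun i hi ↦
    ((hg i hi).1.2.le.trans (hmono' (i + 1) m hi le_rfl)).trans htm
  set Wp : Finset ℝ := (Finset.range m).image g with hWp
  set Wm : Finset ℝ := Wp.image (fun x : ℝ ↦ -x) with hWm
  have hWp_card : Wp.card = m := by rw [hWp, Finset.card_image_of_injOn hg_inj, Finset.card_range]
  have hWm_card : Wm.card = m := by rw [hWm, Finset.card_image_of_injective _ neg_injective, hWp_card]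
  have hWp_pos : ∀ γ ∈ Wp, 0 < γ := by
    intro γ hγ
    obtain ⟨i, hi, rfl⟩ := Finset.mem_image.1 hγ
    exact hg_pos i (Finset.mem_range.1 hi)
  have hWm_neg : ∀ γ ∈ Wm, γ < 0 := by
    intro γ hγ
    obtain ⟨x, hx, rfl⟩ := Finset.mem_image.1 hγ
    exact neg_lt_zero.2 (hWp_pos x hx)
  have hdisj : Disjoint Wp Wm :=
    Finset.disjoint_left.2 fun γ hγp hγm ↦ lt_irrefl _ ((hWm_neg γ hγm).trans (hWp_pos γ hγp))
  refine ⟨Wp ∪ Wm, by rw [Finset.card_union_of_disjoint hdisj, hWp_card, hWm_card]; ring, ?_⟩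
  intro γ hγ
  rcases Finset.mem_union.1 hγ with hγ | hγ
  · obtain ⟨i, hi, rfl⟩ := Finset.mem_image.1 hγ
    have hi' := Finset.mem_range.1 hi
    exact ⟨(hg i hi').2, by rw [abs_of_pos (hg_pos i hi')]; exact hg_le i hi'⟩
  · obtain ⟨x, hx, rfl⟩ := Finset.mem_image.1 hγ
    obtain ⟨i, hi, rfl⟩ := Finset.mem_image.1 hx
    have hi' := Finset.mem_range.1 hi
    refine ⟨?_, by rw [abs_neg, abs_of_pos (hg_pos i hi')]; exact hg_le i hi'⟩
    have := (LFunction_half_neg_eq_zero_iff_of_isQuadratic hχ2 h1 (g i)).2 (hg i hi').2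
    simpa using this

/-- **F-points above `T` with alternating signs select zeros in `(T, T + h]`** with
`Σ_{j<k} (T + h − u_{j+1}) ≤ Σ_γ (T + h − γ)`: if `T ≤ u₀ < u₁ < ⋯ < u_k ≤ T + h` (`T ≥ 0`) and
`Re ξ(½ + iu_{j−1}, χ)·Re ξ(½ + iu_j, χ) < 0`, the selected zeros `γ_j ∈ (u_{j−1}, u_j)` are distinct and each lies
below the next F-point («replacing each `ρ` by the next F-point», Rumely p. 434).
[cite: Rumely1993ERH, §3 Proposition 3 p. 428 and §4 p. 434] -/
theorem exists_zerosAbove_of_alternating (hχ : χ.IsPrimitive) (hχ2 : χ.IsQuadratic) (h1 : χ ≠ 1)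
    {k : ℕ} {u : ℕ → ℝ} {T h : ℝ} (hT0 : 0 ≤ T) (hu0 : T ≤ u 0) (hmono : ∀ j < k, u j < u (j + 1))
    (halt : ∀ j < k, (dirichletXi χ (1 / 2 + u j * I)).re * (dirichletXi χ (1 / 2 + u (j + 1) * I)).re < 0)
    (huk : u k ≤ T + h) :
    ∃ Z : Finset ℝ, (∀ γ ∈ Z, χ.LFunction (1 / 2 + γ * I) = 0 ∧ T < γ ∧ γ ≤ T + h) ∧
      ∑ j ∈ Finset.range k, (T + h - u (j + 1)) ≤ ∑ γ ∈ Z, (T + h - γ) := by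
  classical
  have hmono' := le_of_chain hmono
  obtain ⟨g, hg, hg_inj⟩ := exists_selector_of_alternating hχ hχ2 h1 (hT0.trans hu0) hmono halt
  refine ⟨(Finset.range k).image g, ?_, ?_⟩
  · intro γ hγ
    obtain ⟨j, hj, rfl⟩ := Finset.mem_image.1 hγ
    have hj' := Finset.mem_range.1 hj
    exact ⟨(hg j hj').2, (hu0.trans (hmono' 0 j (Nat.zero_le _) hj'.le)).trans_lt (hg j hj').1.1,
      ((hg j hj').1.2.le.trans (hmono' (j + 1) k hj' le_rfl)).trans huk⟩
  · rw [Finset.sum_image hg_inj]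
    exact Finset.sum_le_sum fun j hj ↦ by linarith [(hg j (Finset.mem_range.1 hj)).1.2]

/-- **Turing's method for a real primitive character from an F-point list** (Rumely's Proposition 3 format
below `T`, sign-change intervals above): `0 ≤ t₀ < ⋯ < t_m ≤ T` with `Re ξ(½ + it_{i−1}, χ)·Re ξ(½ + it_i, χ) < 0`,
`𝒵₂` sign-change data with intervals in `(T, T+h]`, `T > 50`, `h > 0`, and
`2(2.26 + 0.0642 log(q(T+h)/2π)) + (2/π)∫_T^{T+h} θ − 2 Σ_{[a,b]∈𝒵₂} (T + h − b) < h(2m + 1)` give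
`LFunctionRHUpTo χ T ∧ N_χ(T) = N_{χ,0}(T) = 2m` — no side condition on the heights.
[cite: Rumely1993ERH, §3 Proposition 3 p. 428] [cite: Platt2016GRH, Theorem 3.2] -/
theorem _root_.Literature.NumberTheory.LFunctions.LFunctionRHUpTo.of_turing_FPoints
    (hcheck : trudgianCheck = true)
    (hχ : χ.IsPrimitive) (hχ2 : χ.IsQuadratic) (hq : 1 < q) {T h : ℝ} (hT : 50 < T) (hh : 0 < h)
    {m : ℕ} {t : ℕ → ℝ} (ht0 : 0 ≤ t 0) (hmono : ∀ i < m, t i < t (i + 1))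
    (halt : ∀ i < m, (dirichletXi χ (1 / 2 + t i * I)).re * (dirichletXi χ (1 / 2 + t (i + 1) * I)).re < 0)
    (htm : t m ≤ T)
    {Z₂ : Finset (ℝ × ℝ)} (hZ₂ : IsSignChangeData χ (T + h) Z₂) (hZ₂T : ∀ P ∈ Z₂, T < P.1)
    (hnum : 2 * (2.26 + 0.0642 * Real.log (q * (T + h) / (2 * π))) +
        2 / π * (∫ t in T..T + h, lfunctionTheta χ t) - 2 * ∑ P ∈ Z₂, (T + h - P.2) <
        h * (2 * m + 1)) :
    LFunctionRHUpTo χ T ∧ lfunctionZeroCount χ T = 2 * m ∧ lfunctionCriticalZeroCount χ T = 2 * m := by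
  have h1 : χ ≠ 1 := ne_one_of_isPrimitive_of_one_lt hχ hq
  obtain ⟨W, hWn, hW⟩ := exists_criticalZeros_of_alternating hχ hχ2 h1 ht0 hmono halt htm
  rw [← hWn]
  refine LFunctionRHUpTo.of_turing_foundZeros' hcheck hχ hχ2 hq hT hh W hW hZ₂ hZ₂T ?_
  rw [hWn]; push_cast; exact hnum

/-- **Turing's method for a real primitive character from F-point lists ONLY** (Rumely's Proposition 3 format
below AND above `T`): `0 ≤ t₀ < ⋯ < t_m ≤ T` and `T ≤ u₀ < ⋯ < u_k ≤ T + h` with alternating signs of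
`Re ξ(½ + i·, χ)` along each list, `T > 50`, `h > 0`, and
`2(2.26 + 0.0642 log(q(T+h)/2π)) + (2/π)∫_T^{T+h} θ − 2 Σ_{j=1}^{k} (T + h − u_j) < h(2m + 1)` give
`LFunctionRHUpTo χ T ∧ N_χ(T) = N_{χ,0}(T) = 2m` — no side condition on the heights; `m + k + 2` sign
determinations, one integral enclosure, one comparison. [cite: Rumely1993ERH, §3 Proposition 3 p. 428]
[cite: Platt2016GRH, Theorem 3.2] -/
theorem _root_.Literature.NumberTheory.LFunctions.LFunctionRHUpTo.of_turing_FPointLists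
    (hcheck : trudgianCheck = true)
    (hχ : χ.IsPrimitive) (hχ2 : χ.IsQuadratic) (hq : 1 < q) {T h : ℝ} (hT : 50 < T) (hh : 0 < h)
    {m : ℕ} {t : ℕ → ℝ} (ht0 : 0 ≤ t 0) (htmono : ∀ i < m, t i < t (i + 1))
    (htalt : ∀ i < m, (dirichletXi χ (1 / 2 + t i * I)).re * (dirichletXi χ (1 / 2 + t (i + 1) * I)).re < 0)
    (htm : t m ≤ T)
    {k : ℕ} {u : ℕ → ℝ} (hu0 : T ≤ u 0) (humono : ∀ j < k, u j < u (j + 1))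
    (hualt : ∀ j < k, (dirichletXi χ (1 / 2 + u j * I)).re * (dirichletXi χ (1 / 2 + u (j + 1) * I)).re < 0)
    (huk : u k ≤ T + h)
    (hnum : 2 * (2.26 + 0.0642 * Real.log (q * (T + h) / (2 * π))) +
        2 / π * (∫ t in T..T + h, lfunctionTheta χ t) - 2 * ∑ j ∈ Finset.range k, (T + h - u (j + 1)) <
        h * (2 * m + 1)) :
    LFunctionRHUpTo χ T ∧ lfunctionZeroCount χ T = 2 * m ∧ lfunctionCriticalZeroCount χ T = 2 * m := by
  have h1 : χ ≠ 1 := ne_one_of_isPrimitive_of_one_lt hχ hq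
  obtain ⟨W, hWn, hW⟩ := exists_criticalZeros_of_alternating hχ hχ2 h1 ht0 htmono htalt htm
  obtain ⟨Z, hZ, hS⟩ := exists_zerosAbove_of_alternating hχ hχ2 h1 (by linarith) hu0 humono hualt huk
  rw [← hWn]
  refine LFunctionRHUpTo.of_turing_real' hcheck hχ hχ2 hq hT hh W hW Z hZ hS ?_
  rw [hWn]; push_cast; exact hnum

/-! ### Instances: the real primitive characters of conductor `3, 4, 5, 7, 8` -/

/-- If every unit of `ZMod q` has square `1` (true for `q ∣ 24`), every Dirichlet character mod `q` is quadratic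
(`χ(u)² = χ(u²) = 1`; MV §9.3: the real characters are those of order `≤ 2`). [cite: MontgomeryVaughan2007, §9.3] -/
theorem isQuadratic_of_units_sq_eq_one (h : ∀ u : (ZMod q)ˣ, u ^ 2 = 1) (χ : DirichletCharacter ℂ q) :
    χ.IsQuadratic := by
  intro a
  by_cases ha : IsUnit a
  · obtain ⟨u, rfl⟩ := ha
    have hsq : χ u * χ u = 1 := by
      rw [← map_mul, ← Units.val_mul, ← sq, h u, Units.val_one, map_one]
    exact Or.inr (mul_self_eq_one_iff.1 hsq)
  · exact Or.inl (χ.map_nonunit ha)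

/-- Every Dirichlet character mod `3` is quadratic (`(ℤ/3)ˣ` has exponent `2`). [cite: MontgomeryVaughan2007, §9.3] -/
theorem isQuadratic_mod3 (χ : DirichletCharacter ℂ 3) : χ.IsQuadratic :=
  isQuadratic_of_units_sq_eq_one (by decide) χ

/-- Every Dirichlet character mod `8` is quadratic (`(ℤ/8)ˣ` has exponent `2`). [cite: MontgomeryVaughan2007, §9.3] -/
theorem isQuadratic_mod8 (χ : DirichletCharacter ℂ 8) : χ.IsQuadratic :=
  isQuadratic_of_units_sq_eq_one (by decide) χ

end TuringDirichlet

open TuringDirichlet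

/-- **Conductor `3`** (`χ = (−3/·)`, the primitive character mod `3`; Rumely's Table 5.5 row `Q = 3`: `46` zeros with
`0 < γ < 100`, …, `11891` with `0 < γ < 10⁴`): sign-change data `𝒵₁ ⊆ [0, T]`, `𝒵₂ ⊆ (T, T+h]` and
`2(2.26 + 0.0642 log(3(T+h)/2π)) + (2/π)∫_T^{T+h} θ − 2Σ_{𝒵₂}(T+h−b) < h(2#𝒵₁ + 1)` certify
`LFunctionRHUpTo χ T ∧ N_χ(T) = 2#𝒵₁` — no side condition on the heights (`of_turing_signChanges'`).
[cite: Rumely1993ERH, §3 Proposition 3 p. 428; Supplement Table 5.5 (Q = 3)] -/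
theorem LFunctionRHUpTo.of_turing_signChanges_mod3 (hcheck : trudgianCheck = true)
    {χ : DirichletCharacter ℂ 3} (hχ : χ.IsPrimitive)
    {T h : ℝ} (hT : 50 < T) (hh : 0 < h)
    {Z₁ : Finset (ℝ × ℝ)} (hZ₁ : IsSignChangeData χ T Z₁)
    {Z₂ : Finset (ℝ × ℝ)} (hZ₂ : IsSignChangeData χ (T + h) Z₂) (hZ₂T : ∀ P ∈ Z₂, T < P.1)
    (hnum : 2 * (2.26 + 0.0642 * Real.log (3 * (T + h) / (2 * π))) +
        2 / π * (∫ t in T..T + h, lfunctionTheta χ t) - 2 * ∑ P ∈ Z₂, (T + h - P.2) <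
        h * (2 * Z₁.card + 1)) :
    LFunctionRHUpTo χ T ∧ lfunctionZeroCount χ T = 2 * Z₁.card ∧
      lfunctionCriticalZeroCount χ T = 2 * Z₁.card :=
  LFunctionRHUpTo.of_turing_signChanges' hcheck hχ (isQuadratic_mod3 χ) (by norm_num) hT hh hZ₁ hZ₂ hZ₂T
    (by exact_mod_cast hnum)

/-- **Conductor `4`** (`χ = (−4/·)`; Table 5.5 row `Q = 4`: `50, 379, 868, 2536, 5623, 12349` zeros below
`100, …, 10⁴`): the sign-change certificate for the primitive character mod `4`.
[cite: Rumely1993ERH, §3 Proposition 3 p. 428; Supplement Table 5.5 (Q = 4)] -/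
theorem LFunctionRHUpTo.of_turing_signChanges_mod4 (hcheck : trudgianCheck = true)
    {χ : DirichletCharacter ℂ 4} (hχ : χ.IsPrimitive)
    {T h : ℝ} (hT : 50 < T) (hh : 0 < h)
    {Z₁ : Finset (ℝ × ℝ)} (hZ₁ : IsSignChangeData χ T Z₁)
    {Z₂ : Finset (ℝ × ℝ)} (hZ₂ : IsSignChangeData χ (T + h) Z₂) (hZ₂T : ∀ P ∈ Z₂, T < P.1)
    (hnum : 2 * (2.26 + 0.0642 * Real.log (4 * (T + h) / (2 * π))) +
        2 / π * (∫ t in T..T + h, lfunctionTheta χ t) - 2 * ∑ P ∈ Z₂, (T + h - P.2) <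
        h * (2 * Z₁.card + 1)) :
    LFunctionRHUpTo χ T ∧ lfunctionZeroCount χ T = 2 * Z₁.card ∧
      lfunctionCriticalZeroCount χ T = 2 * Z₁.card :=
  LFunctionRHUpTo.of_turing_signChanges' hcheck hχ (HurwitzNumerics.isQuadratic_of_modulus_four χ) (by norm_num)
    hT hh hZ₁ hZ₂ hZ₂T
    (by exact_mod_cast hnum)

/-- **Conductor `5`** (`χ = (5/·)`, the quadratic primitive character mod `5`; Table 5.5 row `Q = 5, K = 3`:
`54, 397, 904, 2624, 5800, 12703`): the sign-change certificate.
[cite: Rumely1993ERH, §3 Proposition 3 p. 428; Supplement Table 5.5 (Q = 5, K = 3)] -/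
theorem LFunctionRHUpTo.of_turing_signChanges_mod5 (hcheck : trudgianCheck = true)
    {χ : DirichletCharacter ℂ 5} (hχ : χ.IsPrimitive)
    (hχ2 : χ.IsQuadratic) {T h : ℝ} (hT : 50 < T) (hh : 0 < h)
    {Z₁ : Finset (ℝ × ℝ)} (hZ₁ : IsSignChangeData χ T Z₁)
    {Z₂ : Finset (ℝ × ℝ)} (hZ₂ : IsSignChangeData χ (T + h) Z₂) (hZ₂T : ∀ P ∈ Z₂, T < P.1)
    (hnum : 2 * (2.26 + 0.0642 * Real.log (5 * (T + h) / (2 * π))) +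
        2 / π * (∫ t in T..T + h, lfunctionTheta χ t) - 2 * ∑ P ∈ Z₂, (T + h - P.2) <
        h * (2 * Z₁.card + 1)) :
    LFunctionRHUpTo χ T ∧ lfunctionZeroCount χ T = 2 * Z₁.card ∧
      lfunctionCriticalZeroCount χ T = 2 * Z₁.card :=
  LFunctionRHUpTo.of_turing_signChanges' hcheck hχ hχ2 (by norm_num) hT hh hZ₁ hZ₂ hZ₂T
    (by exact_mod_cast hnum)

/-- **Conductor `7`** (`χ = (−7/·)`, the quadratic primitive character mod `7`; Table 5.5 row `Q = 7, K = 5`: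
`59, 424, 958, 2759, 6068, 13239`): the sign-change certificate.
[cite: Rumely1993ERH, §3 Proposition 3 p. 428; Supplement Table 5.5 (Q = 7, K = 5)] -/
theorem LFunctionRHUpTo.of_turing_signChanges_mod7 (hcheck : trudgianCheck = true)
    {χ : DirichletCharacter ℂ 7} (hχ : χ.IsPrimitive)
    (hχ2 : χ.IsQuadratic) {T h : ℝ} (hT : 50 < T) (hh : 0 < h)
    {Z₁ : Finset (ℝ × ℝ)} (hZ₁ : IsSignChangeData χ T Z₁)
    {Z₂ : Finset (ℝ × ℝ)} (hZ₂ : IsSignChangeData χ (T + h) Z₂) (hZ₂T : ∀ P ∈ Z₂, T < P.1)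
    (hnum : 2 * (2.26 + 0.0642 * Real.log (7 * (T + h) / (2 * π))) +
        2 / π * (∫ t in T..T + h, lfunctionTheta χ t) - 2 * ∑ P ∈ Z₂, (T + h - P.2) <
        h * (2 * Z₁.card + 1)) :
    LFunctionRHUpTo χ T ∧ lfunctionZeroCount χ T = 2 * Z₁.card ∧
      lfunctionCriticalZeroCount χ T = 2 * Z₁.card :=
  LFunctionRHUpTo.of_turing_signChanges' hcheck hχ hχ2 (by norm_num) hT hh hZ₁ hZ₂ hZ₂T
    (by exact_mod_cast hnum)

/-- **Conductor `8`** (both primitive characters mod `8`, `(−8/·)` odd and `(8/·)` even, are quadratic; Table 5.5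
rows `Q = 8`, `K = 1, 2`: `61, 435/434, 979, 2811, 6174, 13452`): the sign-change certificate.
[cite: Rumely1993ERH, §3 Proposition 3 p. 428; Supplement Table 5.5 (Q = 8)] -/
theorem LFunctionRHUpTo.of_turing_signChanges_mod8 (hcheck : trudgianCheck = true)
    {χ : DirichletCharacter ℂ 8} (hχ : χ.IsPrimitive)
    {T h : ℝ} (hT : 50 < T) (hh : 0 < h)
    {Z₁ : Finset (ℝ × ℝ)} (hZ₁ : IsSignChangeData χ T Z₁)
    {Z₂ : Finset (ℝ × ℝ)} (hZ₂ : IsSignChangeData χ (T + h) Z₂) (hZ₂T : ∀ P ∈ Z₂, T < P.1)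
    (hnum : 2 * (2.26 + 0.0642 * Real.log (8 * (T + h) / (2 * π))) +
        2 / π * (∫ t in T..T + h, lfunctionTheta χ t) - 2 * ∑ P ∈ Z₂, (T + h - P.2) <
        h * (2 * Z₁.card + 1)) :
    LFunctionRHUpTo χ T ∧ lfunctionZeroCount χ T = 2 * Z₁.card ∧
      lfunctionCriticalZeroCount χ T = 2 * Z₁.card :=
  LFunctionRHUpTo.of_turing_signChanges' hcheck hχ (isQuadratic_mod8 χ) (by norm_num) hT hh hZ₁ hZ₂ hZ₂T
    (by exact_mod_cast hnum)

end Literature.NumberTheory.LFunctions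

end
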